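import Summits.FinalStateConjecture.FinalStateConjecture.Theorems.KerrShieldedDataExist.Negative.BentSliceConormal
import Summits.FinalStateConjecture.FinalStateConjecture.Theorems.SwallowTheDatumKerrShieldedSettlesStubCollarCauchy
import Literature.Geometry.Lorentzian.KerrTimelikeSpan
import Literature.Geometry.Lorentzian.KerrAxialSymmetry
import Literature.Geometry.Lorentzian.KerrSchildCoord
import Literature.Geometry.Lorentzian.KerrData
import Literature.Geometry.Lorentzian.OpensCausality
import HarnessLib

/-!
# `KerrShieldedSettles`, line `tapered-temporal-collar` — stub S6c `stub_kerrExteriorHelix`: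
# the DRSR helix of the sub-extremal Kerr exterior as a causal connector

Support file for crux `stmt-FinalStateConjecture-10054`
(`Summit.FinalStateConjecture.FinalStateConjecture.Theses.SwallowTheDatum.KerrShieldedSettles`), stub
`stub_kerrExteriorHelix` (consumed verbatim by S6a `stub_kerrExteriorDecomposition`).

On the whole sub-extremal exterior `{r > r₊}` of the ingoing Kerr–Schild chart (ergoregion included, where
`∂_{t*}` is spacelike) the vector field `V = ∂_{t*} + ω(r) (x₁ ∂₂ − x₂ ∂₁)`, `ω(r) = 2Mar/(r² + a²)²`, is
future timelike (Dafermos–Rodnianski–Shlapentokh-Rothman, arXiv:1402.7034, Lemma 4.7.1; the tree's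
`Kerr.bilin_drsrVector_neg`).  Its integral curve through `x` is the **helix**
`h(t) = (x⁰ + t, R_{ω t} x⃗) = (x⁰ + t, x₁ cos ωt − x₂ sin ωt, x₁ sin ωt + x₂ cos ωt, x₃)`, `ω = ω(r(x))`,
`R_α` the rotation of the `(x₁, x₂)`-plane (`E4.axialRotation`): rotations and `t*`-translations preserve
the Kerr–Schild radius (`Kerr.radius_axialRotation`, `Kerr.radius_add_time_smul_basisVector`), so
`r(h(t)) = r(x)` and `ḣ(t) = V(h(t))`.  Hence (no new definitions: the helix is written out in coordinates)

* `KerrExteriorHelix.exists_helixCurve`: the helix is a future timelike curve of the chart `Kerr.region a r₁`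
  on every parameter set;
* part (A) of the stub: the helix point `h(Δ)`, `Δ ≥ 0`, has the radius of `x`, lies in `J⁺({x})`, and in
  `I⁺({x})` for `Δ > 0`;
* part (B): if `T(r(x)) ≤ x⁰` (`T = bentHeight M a`), the helix point `h(−Δ)`, `Δ = x⁰ − T(r(x))`, lies on
  the bent leaf `{z⁰ = T(r(z))}` and the helix runs from it to `h(0) = x`, so `x ∈ J⁺(leaf)`.

References: Dafermos–Rodnianski–Shlapentokh-Rothman, Ann. of Math. 183 (2016), Lemma 4.7.1; O'Neill 1983,
Ch. 14, p. 402 (`I⁺ ⊆ J⁺`, `S ⊆ J⁺(S)`); O'Neill 1995, Ch. 2, §2.2 (axial symmetry).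
-/

set_option linter.dupNamespace false

noncomputable section

open Set Filter
open scoped Manifold ContDiff Topology
open Literature.Geometry.Lorentzian
open Summit.FinalStateConjecture.FinalStateConjecture.Theorems.KerrShieldedDataExist.Negative (bentHeight)

namespace Summit.FinalStateConjecture.FinalStateConjecture.Theorems.SwallowTheDatum.KerrShieldedSettles

namespace KerrExteriorHelix

/-! ## The helix in coordinates -/

section Coordinates

/-- The helix point `h(t) = (x⁰ + t, x₁ cos Ωt − x₂ sin Ωt, x₁ sin Ωt + x₂ cos Ωt, x₃)` is the axial
rotation of `x` by the angle `Ω t` followed by the `t*`-translation by `t`. O'Neill 1995, Ch. 2, §2.2.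
[folklore] -/
theorem helix_eq_axialRotation (Ω : ℝ) (x : E4) (t : ℝ) :
    (WithLp.toLp 2 ![x 0 + t, x 1 * Real.cos (Ω * t) - x 2 * Real.sin (Ω * t),
        x 1 * Real.sin (Ω * t) + x 2 * Real.cos (Ω * t), x 3] : E4) =
      E4.axialRotation (Ω * t) x + t • E4.basisVector 0 := by
  ext i
  fin_cases i <;> simp <;> ring

/-- `h(0) = x`. [folklore] -/
theorem helix_zero (Ω : ℝ) (x : E4) :
    (WithLp.toLp 2 ![x 0 + 0, x 1 * Real.cos (Ω * 0) - x 2 * Real.sin (Ω * 0),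
        x 1 * Real.sin (Ω * 0) + x 2 * Real.cos (Ω * 0), x 3] : E4) = x := by
  ext i
  fin_cases i <;> simp

/-- **The helix has constant Kerr–Schild radius** (rotations about the `z`-axis and `t*`-translations
preserve `r`; Visser arXiv:0706.0622, (35)). [folklore] -/
theorem radius_helix (a Ω : ℝ) (x : E4) (t : ℝ) :
    Kerr.radius a (WithLp.toLp 2 ![x 0 + t, x 1 * Real.cos (Ω * t) - x 2 * Real.sin (Ω * t),
        x 1 * Real.sin (Ω * t) + x 2 * Real.cos (Ω * t), x 3] : E4) = Kerr.radius a x := by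
  rw [helix_eq_axialRotation, Kerr.radius_add_time_smul_basisVector, Kerr.radius_axialRotation]

/-- **The velocity of the helix** is `∂_{t*} + Ω (h₁ ∂₂ − h₂ ∂₁)` at the point `h(t)`
(`Kerr.axialVector y = y₁ ∂₂ − y₂ ∂₁`). [folklore] -/
theorem hasDerivAt_helix (Ω : ℝ) (x : E4) (t : ℝ) :
    HasDerivAt (fun s : ℝ ↦ (WithLp.toLp 2 ![x 0 + s, x 1 * Real.cos (Ω * s) - x 2 * Real.sin (Ω * s),
        x 1 * Real.sin (Ω * s) + x 2 * Real.cos (Ω * s), x 3] : E4))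
      (E4.basisVector 0 + Ω • Kerr.axialVector (WithLp.toLp 2 ![x 0 + t,
        x 1 * Real.cos (Ω * t) - x 2 * Real.sin (Ω * t),
        x 1 * Real.sin (Ω * t) + x 2 * Real.cos (Ω * t), x 3] : E4)) t := by
  have hΩt : HasDerivAt (fun s : ℝ ↦ Ω * s) Ω t := by simpa using (hasDerivAt_id t).const_mul Ω
  have hc : HasDerivAt (fun s : ℝ ↦ Real.cos (Ω * s)) (-Real.sin (Ω * t) * Ω) t :=
    (Real.hasDerivAt_cos (Ω * t)).comp t hΩt
  have hs : HasDerivAt (fun s : ℝ ↦ Real.sin (Ω * s)) (Real.cos (Ω * t) * Ω) t :=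
    (Real.hasDerivAt_sin (Ω * t)).comp t hΩt
  have h0 : HasDerivAt (fun s : ℝ ↦ x 0 + s) 1 t := (hasDerivAt_id t).const_add (x 0)
  have h1 : HasDerivAt (fun s : ℝ ↦ x 1 * Real.cos (Ω * s) - x 2 * Real.sin (Ω * s))
      (x 1 * (-Real.sin (Ω * t) * Ω) - x 2 * (Real.cos (Ω * t) * Ω)) t :=
    (hc.const_mul (x 1)).sub (hs.const_mul (x 2))
  have h2 : HasDerivAt (fun s : ℝ ↦ x 1 * Real.sin (Ω * s) + x 2 * Real.cos (Ω * s))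
      (x 1 * (Real.cos (Ω * t) * Ω) + x 2 * (-Real.sin (Ω * t) * Ω)) t :=
    (hs.const_mul (x 1)).add (hc.const_mul (x 2))
  have h3 : HasDerivAt (fun _ : ℝ ↦ x 3) 0 t := hasDerivAt_const t (x 3)
  have h := (((h0.smul_const (E4.basisVector 0)).add (h1.smul_const (E4.basisVector 1))).add
    (h2.smul_const (E4.basisVector 2))).add (h3.smul_const (E4.basisVector 3))
  have hfun : (fun s : ℝ ↦ (WithLp.toLp 2 ![x 0 + s, x 1 * Real.cos (Ω * s) - x 2 * Real.sin (Ω * s),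
      x 1 * Real.sin (Ω * s) + x 2 * Real.cos (Ω * s), x 3] : E4)) = fun s ↦ (x 0 + s) • E4.basisVector 0 +
      (x 1 * Real.cos (Ω * s) - x 2 * Real.sin (Ω * s)) • E4.basisVector 1 +
      (x 1 * Real.sin (Ω * s) + x 2 * Real.cos (Ω * s)) • E4.basisVector 2 +
      (x 3) • E4.basisVector 3 := by
    funext s
    ext i
    fin_cases i <;> simp
  rw [hfun]
  refine h.congr_deriv ?_
  ext i
  fin_cases i <;> simp [Kerr.axialVector] <;> ring

end Coordinates

/-! ## The helix as a future timelike curve of the chart -/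

section Chart

variable [Kerr.Facts] {M a r₁ : ℝ}

/-- **The helix is a future timelike curve of the sub-extremal Kerr chart** through every point `x` with
`r(x) > r₊`: there is a chart curve `γ` whose coordinate expression is the helix
`t ↦ (x⁰ + t, R_{ωt} x⃗)`, `ω = ω(r(x)) = 2Mar/(r² + a²)²`, and which is future timelike on every parameter
set — its velocity is the DRSR vector `V = ∂_{t*} + ω(r) Φ` (`r` is constant along the helix), timelike off
the horizon for `|a| < M` (DRSR Lemma 4.7.1, `Kerr.bilin_drsrVector_neg`) and future-directed (`V⁰ = 1`,
`g(−g♯dt*, V) = −1`). [cite: DafermosRodnianskiShlapentokhrothman2014, Lemma 4.7.1] -/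
theorem exists_helixCurve (hM : 0 ≤ M) (ha : |a| < M) (x : Kerr.region a r₁)
    (hx : Kerr.rPlus M a < Kerr.radius a (x : E4)) :
    ∃ γ : ℝ → Kerr.region a r₁,
      (∀ t, (γ t : E4) = WithLp.toLp 2 ![(x : E4) 0 + t,
          (x : E4) 1 * Real.cos (Kerr.drsrAngularVelocity M a (Kerr.radius a (x : E4)) * t) -
            (x : E4) 2 * Real.sin (Kerr.drsrAngularVelocity M a (Kerr.radius a (x : E4)) * t),
          (x : E4) 1 * Real.sin (Kerr.drsrAngularVelocity M a (Kerr.radius a (x : E4)) * t) +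
            (x : E4) 2 * Real.cos (Kerr.drsrAngularVelocity M a (Kerr.radius a (x : E4)) * t),
          (x : E4) 3]) ∧
      ∀ s : Set ℝ, (Kerr.smoothMetric M a r₁).IsFutureTimelikeCurveOn
        ((Kerr.timeOrientation M a r₁ hM).ofLE le_top) γ s := by
  set Ω : ℝ := Kerr.drsrAngularVelocity M a (Kerr.radius a (x : E4)) with hΩ
  set h : ℝ → E4 := fun t ↦ WithLp.toLp 2 ![(x : E4) 0 + t,
    (x : E4) 1 * Real.cos (Ω * t) - (x : E4) 2 * Real.sin (Ω * t),
    (x : E4) 1 * Real.sin (Ω * t) + (x : E4) 2 * Real.cos (Ω * t), (x : E4) 3] with hh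
  have hrad : ∀ t, Kerr.radius a (h t) = Kerr.radius a (x : E4) := fun t ↦ radius_helix a Ω x t
  have hmem : ∀ t, h t ∈ Kerr.region a r₁ := fun t ↦ by
    rw [Kerr.mem_region, hrad]
    exact x.2
  refine ⟨fun t ↦ ⟨h t, hmem t⟩, fun t ↦ rfl, fun s t _ ↦ ?_⟩
  set γ : ℝ → Kerr.region a r₁ := fun t ↦ ⟨h t, hmem t⟩ with hγ
  have hd : HasDerivAt (fun σ ↦ (γ σ : E4)) (Kerr.drsrVector M a (γ t : E4)) t := by
    have h1 := hasDerivAt_helix Ω x t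
    have h2 : Kerr.drsrVector M a (γ t : E4) = E4.basisVector 0 + Ω • Kerr.axialVector (h t) := by
      rw [Kerr.drsrVector, show (γ t : E4) = h t from rfl, hrad]
    rw [h2]
    exact h1
  have hmd : MDifferentiableAt 𝓘(ℝ, ℝ) 𝓘(ℝ, E4) γ t :=
    (mdifferentiableAt_subtypeVal_comp_curve_iff (I := 𝓘(ℝ, E4)) (Kerr.region a r₁)).1
      (mdifferentiableAt_iff_differentiableAt.2 hd.differentiableAt)
  have hv : (velocity 𝓘(ℝ, E4) γ t : E4) = Kerr.drsrVector M a (γ t : E4) := by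
    rw [CollarCauchy.velocity_eq_deriv, hd.deriv]
  have hpos : 0 < Kerr.radius a (γ t : E4) := Kerr.radius_pos_of_mem_region (γ t).2
  have hx' : Kerr.rPlus M a < Kerr.radius a (γ t : E4) := by
    rw [show (γ t : E4) = h t from rfl, hrad]; exact hx
  have htl : Kerr.bilin M a (γ t : E4) (Kerr.drsrVector M a (γ t : E4)) (Kerr.drsrVector M a (γ t : E4)) < 0 :=
    Kerr.bilin_drsrVector_neg ha hx'
  have hne := Kerr.drsrVector_ne_zero M a (γ t : E4)
  refine ⟨hmd, ?_, ⟨?_, ?_⟩, ?_⟩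
  · change Kerr.bilin M a (γ t : E4) (velocity 𝓘(ℝ, E4) γ t) (velocity 𝓘(ℝ, E4) γ t) < 0
    rw [hv]; exact htl
  · change Kerr.bilin M a (γ t : E4) (velocity 𝓘(ℝ, E4) γ t) (velocity 𝓘(ℝ, E4) γ t) ≤ 0
    rw [hv]; exact htl.le
  · intro h0; exact hne (hv.symm.trans h0)
  · change Kerr.bilin M a (γ t : E4) (Kerr.timeVector M a (γ t : E4)) (velocity 𝓘(ℝ, E4) γ t) < 0
    rw [Kerr.bilin_timeVector hpos, hv, Kerr.drsrVector_apply_zero]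
    norm_num

/-- **The stub, both parts, from the helix.**  For a chart point `x` with `r(x) > r₊` (`|a| < M`, `0 ≤ M`):
(A) for `Δ ≥ 0` the helix point `h(Δ)` is a chart point with `r(h(Δ)) = r(x)`, in `J⁺({x})`, and in `I⁺({x})`
when `Δ > 0` (the helix segment on `[0, Δ]`); (B) if `T(r(x)) ≤ x⁰` then `x ∈ J⁺` of the bent leaf
`{z⁰ = T(r(z))}` (the helix segment on `[−Δ, 0]`, `Δ = x⁰ − T(r(x))`, starts on the leaf since
`r(h(−Δ)) = r(x)`). O'Neill 1983, Ch. 14, p. 402. [cite: ONeillSemiRiemannian1983, Ch. 14, p. 402] -/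
theorem helix_connects (hM : 0 ≤ M) (ha : |a| < M) (x : Kerr.region a r₁)
    (hx : Kerr.rPlus M a < Kerr.radius a (x : E4)) :
    (∀ Δ : ℝ, 0 ≤ Δ → ∃ x' : Kerr.region a r₁,
        (x' : E4) = WithLp.toLp 2 ![(x : E4) 0 + Δ,
            (x : E4) 1 * Real.cos (Kerr.drsrAngularVelocity M a (Kerr.radius a (x : E4)) * Δ) -
              (x : E4) 2 * Real.sin (Kerr.drsrAngularVelocity M a (Kerr.radius a (x : E4)) * Δ),
            (x : E4) 1 * Real.sin (Kerr.drsrAngularVelocity M a (Kerr.radius a (x : E4)) * Δ) +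
              (x : E4) 2 * Real.cos (Kerr.drsrAngularVelocity M a (Kerr.radius a (x : E4)) * Δ),
            (x : E4) 3] ∧
        Kerr.radius a (x' : E4) = Kerr.radius a (x : E4) ∧
        x' ∈ (Kerr.smoothMetric M a r₁).causalFuture ((Kerr.timeOrientation M a r₁ hM).ofLE le_top) {x} ∧
        (0 < Δ → x' ∈ (Kerr.smoothMetric M a r₁).chronologicalFuture
          ((Kerr.timeOrientation M a r₁ hM).ofLE le_top) {x})) ∧
    (bentHeight M a (Kerr.radius a (x : E4)) ≤ (x : E4) 0 →
        x ∈ (Kerr.smoothMetric M a r₁).causalFuture ((Kerr.timeOrientation M a r₁ hM).ofLE le_top)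
          {z : Kerr.region a r₁ | (z : E4) 0 = bentHeight M a (Kerr.radius a (z : E4))}) := by
  obtain ⟨γ, hγ, hcurve⟩ := exists_helixCurve hM ha x hx
  -- the helix starts at `x`, has constant radius and time coordinate `x⁰ + t`
  have hγ0 : γ 0 = x := Subtype.ext ((hγ 0).trans (helix_zero _ _))
  have hrad : ∀ t, Kerr.radius a (γ t : E4) = Kerr.radius a (x : E4) := fun t ↦ by
    rw [hγ t]; exact radius_helix _ _ _ _
  have htime : ∀ t, (γ t : E4) 0 = (x : E4) 0 + t := fun t ↦ by rw [hγ t]; simp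
  -- later helix points are in the chronological future of earlier ones
  have hI : ∀ {t₁ t₂ : ℝ}, t₁ < t₂ → γ t₂ ∈ (Kerr.smoothMetric M a r₁).chronologicalFuture
      ((Kerr.timeOrientation M a r₁ hM).ofLE le_top) {γ t₁} := fun {t₁ t₂} h ↦
    ⟨γ t₁, rfl, γ, t₁, t₂, h, hcurve _, rfl, rfl⟩
  refine ⟨fun Δ hΔ ↦ ⟨γ Δ, hγ Δ, hrad Δ, ?_, fun hpos ↦ ?_⟩, fun hT ↦ ?_⟩
  · rcases hΔ.eq_or_lt with h0 | hpos
    · rw [← h0, hγ0]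
      exact LorentzianMetric.subset_causalFuture _ _ _ (mem_singleton x)
    · have h := hI hpos
      rw [hγ0] at h
      exact LorentzianMetric.chronologicalFuture_subset_causalFuture _ _ _ h
  · have h := hI hpos
    rwa [hγ0] at h
  · set Δ : ℝ := (x : E4) 0 - bentHeight M a (Kerr.radius a (x : E4)) with hΔ_def
    have hΔ : 0 ≤ Δ := sub_nonneg.2 hT
    have hleaf : γ (-Δ) ∈ {z : Kerr.region a r₁ | (z : E4) 0 = bentHeight M a (Kerr.radius a (z : E4))} := by
      show (γ (-Δ) : E4) 0 = bentHeight M a (Kerr.radius a (γ (-Δ) : E4))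
      rw [hrad, htime, hΔ_def]
      ring
    refine LorentzianMetric.causalFuture_mono (singleton_subset_iff.2 hleaf) ?_
    rcases hΔ.eq_or_lt with h0 | hpos
    · have hx0 : γ (-Δ) = x := by rw [← h0, neg_zero, hγ0]
      rw [hx0]
      exact LorentzianMetric.subset_causalFuture _ _ _ (mem_singleton x)
    · have h := hI (neg_lt_zero.2 hpos)
      rw [hγ0] at h
      exact LorentzianMetric.chronologicalFuture_subset_causalFuture _ _ _ h

end Chart

end KerrExteriorHelix

open KerrExteriorHelix in
/-- **Registered sub-goal `stub_kerrExteriorHelix` (the DRSR helix of the sub-extremal Kerr exterior as a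
causal connector).**  For sub-extremal `(M, a)`, `0 ≤ M`, `r₋ < r₁ < r₊` and a point `x` of the ingoing
Kerr–Schild chart `Kerr.region a r₁` with `r(x) > r₊`: (A) for every `Δ ≥ 0` the helix point
`x' = (x⁰ + Δ, R_{ωΔ} x⃗)`, `ω = 2Mar/(r² + a²)²` at `r = r(x)`, is a chart point with `r(x') = r(x)`,
`x' ∈ J⁺({x})`, and `x' ∈ I⁺({x})` if `Δ > 0` (the helix `t ↦ (x⁰ + t, R_{ωt} x⃗)` is an integral curve of
the future timelike field `∂_{t*} + ω(r) ∂_φ` of Dafermos–Rodnianski–Shlapentokh-Rothman, Lemma 4.7.1);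
(B) if `T(r(x)) ≤ x⁰`, `T = bentHeight M a`, then `x ∈ J⁺` of the bent leaf `{z⁰ = T(r(z))}` (run the helix
from the leaf point `(T(r(x)), R_{−ωΔ} x⃗)`, `Δ = x⁰ − T(r(x))`).
[cite: DafermosRodnianskiShlapentokhrothman2014, Lemma 4.7.1] -/
theorem stub_kerrExteriorHelix : ∀ [Kerr.Facts] (M a r₁ : ℝ) (hM : 0 ≤ M), |a| < M →
    Kerr.rMinus M a < r₁ → r₁ < Kerr.rPlus M a →
    ∀ (x : Kerr.region a r₁), Kerr.rPlus M a < Kerr.radius a (x : E4) →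
      (∀ Δ : ℝ, 0 ≤ Δ → ∃ x' : Kerr.region a r₁,
          (x' : E4) = WithLp.toLp 2 ![(x : E4) 0 + Δ,
              (x : E4) 1 * Real.cos (Kerr.drsrAngularVelocity M a (Kerr.radius a (x : E4)) * Δ) -
                (x : E4) 2 * Real.sin (Kerr.drsrAngularVelocity M a (Kerr.radius a (x : E4)) * Δ),
              (x : E4) 1 * Real.sin (Kerr.drsrAngularVelocity M a (Kerr.radius a (x : E4)) * Δ) +
                (x : E4) 2 * Real.cos (Kerr.drsrAngularVelocity M a (Kerr.radius a (x : E4)) * Δ),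
              (x : E4) 3] ∧
          Kerr.radius a (x' : E4) = Kerr.radius a (x : E4) ∧
          x' ∈ (Kerr.smoothMetric M a r₁).causalFuture ((Kerr.timeOrientation M a r₁ hM).ofLE le_top) {x} ∧
          (0 < Δ → x' ∈ (Kerr.smoothMetric M a r₁).chronologicalFuture
            ((Kerr.timeOrientation M a r₁ hM).ofLE le_top) {x})) ∧
      (bentHeight M a (Kerr.radius a (x : E4)) ≤ (x : E4) 0 →
          x ∈ (Kerr.smoothMetric M a r₁).causalFuture ((Kerr.timeOrientation M a r₁ hM).ofLE le_top)
            {z : Kerr.region a r₁ | (z : E4) 0 = bentHeight M a (Kerr.radius a (z : E4))}) :=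
  fun _ _ _ hM ha _ _ x hx ↦ helix_connects hM ha x hx

end Summit.FinalStateConjecture.FinalStateConjecture.Theorems.SwallowTheDatum.KerrShieldedSettles

end
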